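import Summits.QuantumFields.YangMills.Theorems.LuscherReductionRunningReductionOneSiteTailFamily
import Summits.QuantumFields.YangMills.Theorems.LuscherReductionRunningReductionOneSiteTailInjection
import Summits.QuantumFields.YangMills.Theorems.LuscherReductionRunningReductionOneSiteTailFlat
import Summits.QuantumFields.YangMills.Theorems.FemtoTransferGapLevelsDecay

/-!
# Crux RED `RunningReduction`, line «KTR» PART 8 — stub `TT.stub_oneSiteTail`, tool 5:
# the B-UNIFORM COUNT in family form — a high `(n+1)`-dimensional physical family forces `physLevel (n+1)` to be small

Support module for crux `RunningReduction` (route `LuscherReduction`, item stmt-QuantumFields-19978), registered stub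
`TT.stub_oneSiteTail` (KTR PART 8; plan of record = ym-cruxidea-19978-2 g10's STUB-READING §2 S2′), fleet base ym-luscher-20007-p1 (gen 4).

Assembly of tools 1–4 (`…OneSiteTailFamily`, `…Injection`, `…Flat`): ONE's AbsUpper lane run «in subspace mode».  For a physical family
`ψ_0 … ψ_n` whose every non-trivial combination `ψ_a = Σ a_i ψ_i` has `‖ψ_a‖² > 0` and `μ‖ψ_a‖² ≤ ⟨ψ_a, K_Bψ_a⟩` with `μ` inside the
injection window `linkCE B·(1 − γ + Dλ_b²) < μ ≤ linkCE B` (`γ` = the k-uniform OUTER gain at this `B`), the maps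
`ψ ↦ cos Θ_Bψ ↦ e^{−BS/2}cos Θ_Bψ ↦ gFlat B ψ ↦ P_{λ_b/2} gFlat B ψ` are linear and `L²`-non-degenerate on the span, and the last family
is a Kac family with Rayleigh quotient `≤ 2(4a′/λ_b + 4706)`, `a′ = linkCE B/(μ − linkCE B·Dλ_b²) − 1`; the min–max door gives
`physLevel (n+1) ≤ 2(4a′/λ_b + 4706)` (`physLevel_le_of_highFamily`).  §1 supplies the finite linearity of `IsPhys`, `gFlat`, `heatSmooth`;
§3–§5 the LEVEL form: the exact `l2`-orthonormal physical eigenfamily `e_0 … e_k` (`exists_isPhys_eigenfamily_of_pos`) is a high family with floor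
`λ_k` (`‖Σa_ie_i‖² = Σa_i²`, `⟨Σa_ie_i, K_BΣa_ie_i⟩ = Σλ_ia_i² ≥ λ_kΣa_i²`), hence **`2(4a′/λ_b + 4706) < physLevel (k+1) ⟹ λ_k(B) ≤ μ`**
(`levelValue_le_of_physLevel_gt_at`).

HONEST FRAMING: the lattice-QM → continuum-QM level count for the ONE-SITE (`L = 1`) three-matrix `SU(2)` model, femto rung R2b1;
nothing here is infinite volume, a mass gap or Clay.  Sorry-free, no new definitions, no named-fact hypotheses.
-/

set_option autoImplicit false

noncomputable section

open MeasureTheory Filter Topology Real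
open scoped ENNReal BigOperators
open Literature.MathematicalPhysics.QuantumFieldTheory
open Literature.MathematicalPhysics.QuantumLattice
open Literature.Analysis.OperatorTheory.YMMatrixModel

namespace Summit.QuantumFields.YangMills.Theorems.FemtoTransferGap.OST

open Summit.QuantumFields.YangMills.Theorems.FemtoTransferGap

/-! ### §1. Finite linearity -/

/-- Finite combinations of physical test functions are physical. [folklore] -/
theorem isPhys_sum_mul {ι : Type*} (s : Finset ι) (ψ : ι → Cfg → ℝ) (hψ : ∀ i, IsPhys (ψ i)) (a : ι → ℝ) :
    IsPhys (fun U => ∑ i ∈ s, a i * ψ i U) := by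
  classical
  induction s using Finset.induction_on with
  | empty =>
    have e : (fun U : Cfg => ∑ i ∈ (∅ : Finset ι), a i * ψ i U) = fun _ => (0 : ℝ) := by funext U; simp
    rw [e]; exact isPhys_const 0
  | insert j s hj ih =>
    have e : (fun U => ∑ i ∈ insert j s, a i * ψ i U) = (a j • ψ j) + fun U => ∑ i ∈ s, a i * ψ i U := by
      funext U; simp [Finset.sum_insert hj]
    rw [e]; exact ((hψ j).smul (a j)).add ih

/-- `gFlat B` is linear: the flat representative of a combination is the combination of the representatives. [folklore] -/
theorem gFlat_sum_mul {ι : Type*} (s : Finset ι) (B : ℝ) (ψ : ι → Cfg → ℝ) (a : ι → ℝ) :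
    gFlat B (fun U => ∑ i ∈ s, a i * ψ i U) = fun y => ∑ i ∈ s, a i * gFlat B (ψ i) y := by
  funext y
  simp only [gFlat, chartFn, Finset.mul_sum]
  refine Finset.sum_congr rfl fun i _ => ?_
  ring

/-- `heatSmooth s` is linear on bounded measurable data. [folklore] -/
theorem heatSmooth_sum_mul {ι : Type*} (S : Finset ι) {s : ℝ} (hs : 0 < s) (G : ι → ZM → ℝ) (hGm : ∀ i, Measurable (G i))
    (M : ι → ℝ) (hGb : ∀ i y, |G i y| ≤ M i) (a : ι → ℝ) (x : ZM) :
    heatSmooth s (fun y => ∑ i ∈ S, a i * G i y) x = ∑ i ∈ S, a i * heatSmooth s (G i) x := by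
  classical
  unfold heatSmooth
  have hI : ∀ i, Integrable fun y => heatKernel s x y * G i y := fun i => integrable_heatKernel_mul hs x (hGm i) (hGb i)
  have e : (fun y => heatKernel s x y * ∑ i ∈ S, a i * G i y) = fun y => ∑ i ∈ S, a i * (heatKernel s x y * G i y) := by
    funext y; rw [Finset.mul_sum]; exact Finset.sum_congr rfl fun i _ => by ring
  rw [e, integral_finsetSum S fun i _ => (hI i).const_mul (a i)]
  exact Finset.sum_congr rfl fun i _ => integral_const_mul _ _

/-- The heat-smoothed flat representative of a physical test function is a Kac function (`λ_b ≤ 1/4`). [folklore] -/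
theorem isKacFn_heatSmooth_gFlat {B : ℝ} (hB : 0 < B) (ht4 : bareLambda B ≤ 1 / 4) {ψ : Cfg → ℝ} (hψ : IsPhys ψ) :
    IsKacFn (heatSmooth (bareLambda B / 2) (gFlat B ψ)) := by
  have ht : 0 < bareLambda B := bareLambda_pos' hB
  obtain ⟨Cψ, hCψ⟩ := hψ.bounded
  have hGm : Measurable (gFlat B ψ) := measurable_gFlat B hψ.measurable
  have hGb : ∀ y, |gFlat B ψ y| ≤ Cψ := abs_gFlat_le hB.le hCψ
  have hGinv : IsGaugeInv (gFlat B ψ) := isGaugeInv_gFlat B hψ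
  have hGsupp : ∀ y, gFlat B ψ y ≠ 0 → ‖y‖ ≤ 7 / Real.sqrt (bareLambda B) := fun y hy => norm_le_of_gFlat_ne_zero hB ht4 hy
  obtain ⟨hGi, hGw, -, -, -⟩ := datum_integrable hGm hGb hGsupp
  exact isKacFn_heatSmooth (half_pos ht) hGm hGb hGi hGinv hGw

/-- The smoothed flat representative is linear in the test function (bounded measurable data). [folklore] -/
theorem heatSmooth_gFlat_sum_mul {B : ℝ} (hB : 0 < B) {n : ℕ} (ψ : Fin (n + 1) → Cfg → ℝ) (hψ : ∀ i, IsPhys (ψ i))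
    (a : Fin (n + 1) → ℝ) :
    heatSmooth (bareLambda B / 2) (gFlat B (fun U => ∑ i, a i * ψ i U)) =
      fun x => ∑ i, a i * heatSmooth (bareLambda B / 2) (gFlat B (ψ i)) x := by
  have ht : 0 < bareLambda B := bareLambda_pos' hB
  funext x
  rw [gFlat_sum_mul]
  have hb : ∀ i, ∃ C, ∀ U, |ψ i U| ≤ C := fun i => (hψ i).bounded
  choose C hC using hb
  exact heatSmooth_sum_mul Finset.univ (half_pos ht) (fun i => gFlat B (ψ i)) (fun i => measurable_gFlat B (hψ i).measurable)
    C (fun i y => abs_gFlat_le hB.le (hC i) y) a x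

/-- `𝔮(0) = 0`. [folklore] -/
theorem energyForm_zero : energyForm (fun _ : ZM => (0 : ℝ)) = 0 := by
  have h := energyForm_smul' isKacFn_zero 0
  rw [zero_pow two_ne_zero, zero_mul, zero_smul] at h
  exact h

/-! ### §2. The count in family form -/

/-- **THE B-UNIFORM COUNT (family form).**  Let `B ≥ 2` with `t = λ_b ≤ 1/600`; suppose the `sin Θ_B`-piece of every physical function obeys
the gain `γ ≤ 1` at this `B` (`outer_uniform`), and let `μ ≤ linkCE B` lie in the window `linkCE B·(1 − γ + D t²) < μ`, `D = (9/4)(π²/4)cM2`,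
with `4a′ + 2t² ≤ 1/2` where `a′ = linkCE B/(μ − linkCE B·D t²) − 1`.  If `ψ_0 … ψ_n` are physical and every combination `ψ_a = Σ a_iψ_i`,
`a ≠ 0`, has `‖ψ_a‖² > 0` and `μ‖ψ_a‖² ≤ ⟨ψ_a, K_Bψ_a⟩`, then `physLevel (n+1) ≤ 2(4a′/t + 4706)`.
[cite: SimonB1983DiscreteSpectrum, §3] [cite: Luscher1983, §3] [cite: ReedSimonIV1978, Thm. XIII.1–2] -/
theorem physLevel_le_of_highFamily {B μ γ : ℝ} (hB2 : 2 ≤ B) (ht600 : bareLambda B ≤ 1 / 600) (hγ : γ ≤ 1)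
    (hout : ∀ φ : Cfg → ℝ, IsPhys φ →
      qform su2Rep B (fun U => Real.sin (onePhase (onePhaseScale B) U) * φ U) (fun U => Real.sin (onePhase (onePhaseScale B) U) * φ U)
        ≤ linkCE B * (1 - γ) * l2 (fun U => Real.sin (onePhase (onePhaseScale B) U) * φ U) (fun U => Real.sin (onePhase (onePhaseScale B) U) * φ U))
    (hμL : μ ≤ linkCE B)
    (hwin : linkCE B * (1 - γ + 9 / 4 * (Real.pi ^ 2 / 4) * cM2 * bareLambda B ^ 2) < μ)
    (hsmall : 4 * (linkCE B / (μ - linkCE B * (9 / 4 * (Real.pi ^ 2 / 4) * cM2 * bareLambda B ^ 2)) - 1) + 2 * bareLambda B ^ 2 ≤ 1 / 2)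
    {n : ℕ} (ψ : Fin (n + 1) → Cfg → ℝ) (hψ : ∀ i, IsPhys (ψ i))
    (hfam : ∀ a : Fin (n + 1) → ℝ, a ≠ 0 →
      0 < l2 (fun U => ∑ i, a i * ψ i U) (fun U => ∑ i, a i * ψ i U) ∧
        μ * l2 (fun U => ∑ i, a i * ψ i U) (fun U => ∑ i, a i * ψ i U)
          ≤ qform su2Rep B (fun U => ∑ i, a i * ψ i U) (fun U => ∑ i, a i * ψ i U)) :
    physLevel (n + 1) ≤
      2 * (4 * (linkCE B / (μ - linkCE B * (9 / 4 * (Real.pi ^ 2 / 4) * cM2 * bareLambda B ^ 2)) - 1) / bareLambda B + 4706) := by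
  have hBpos : 0 < B := by linarith
  have ht : 0 < bareLambda B := bareLambda_pos' hBpos
  have ht4 : bareLambda B ≤ 1 / 4 := by linarith
  have hL : 0 < linkCE B := linkCE_pos hBpos.le
  set t := bareLambda B with htdef
  set Dt : ℝ := 9 / 4 * (Real.pi ^ 2 / 4) * cM2 * t ^ 2 with hDt
  have hDt0 : 0 ≤ Dt := by rw [hDt]; have := cM2_pos; positivity
  set ν : ℝ := μ - linkCE B * Dt with hν
  have hν0 : 0 < ν := by
    rw [hν]
    have : linkCE B * (1 - γ + Dt) = linkCE B * (1 - γ) + linkCE B * Dt := by ring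
    nlinarith [mul_nonneg hL.le (sub_nonneg.2 hγ)]
  have hνL : ν ≤ linkCE B := by rw [hν]; nlinarith [mul_nonneg hL.le hDt0]
  set a' : ℝ := linkCE B / ν - 1 with ha'
  have ha'0 : 0 ≤ a' := by
    rw [ha', sub_nonneg, le_div_iff₀ hν0, one_mul]; exact hνL
  set s : ℝ := 2 * (4 * a' / t + 4706) with hs
  have hs0 : 0 ≤ s := by rw [hs]; positivity
  -- the Kac family
  set u : Fin (n + 1) → ZM → ℝ := fun i => heatSmooth (t / 2) (gFlat B (ψ i)) with hu
  have huK : ∀ i, IsKacFn (u i) := fun i => isKacFn_heatSmooth_gFlat hBpos ht4 (hψ i)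
  -- the chain for a non-trivial combination
  have chain : ∀ a : Fin (n + 1) → ℝ, a ≠ 0 →
      0 < ∫ x, (∑ i, a i * u i x) ^ 2 ∧ energyForm (fun x => ∑ i, a i * u i x) ≤ s * ∫ x, (∑ i, a i * u i x) ^ 2 := by
    intro a ha
    set Ψ : Cfg → ℝ := fun U => ∑ i, a i * ψ i U with hΨ
    have hΨP : IsPhys Ψ := isPhys_sum_mul Finset.univ ψ hψ a
    obtain ⟨hpos, hlow⟩ := hfam a ha
    -- injection
    obtain ⟨hcpos, hclow⟩ := cos_piece_of_window_onePhase hBpos hΨP hpos hlow (hout Ψ hΨP) hwin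
    -- layer I backwards
    have hcP : IsPhys (fun U => Real.cos (onePhase (onePhaseScale B) U) * Ψ U) := isPhys_cos_onePhase_mul _ hΨP
    obtain ⟨hjump, hM0low⟩ := jump_le_of_qform_ge hBpos hν0 hcP hcpos hclow
    -- flatten + heat
    obtain ⟨-, hEn, hmass, hM⟩ := flat_energy_of_jump_le hB2 ht600 hΨP ha'0 hjump
    -- identify the smoothed representative with the combination of the `u i`
    have hlin : heatSmooth (t / 2) (gFlat B Ψ) = fun x => ∑ i, a i * u i x := heatSmooth_gFlat_sum_mul hBpos ψ hψ a
    rw [hlin] at hEn hmass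
    -- positivity of the flat mass
    have hm0 : 0 < ∫ y, gFlat B Ψ y ^ 2 := by
      have h1 : 0 < ν / linkCE B * l2 (fun U => Real.cos (onePhase (onePhaseScale B) U) * Ψ U)
          (fun U => Real.cos (onePhase (onePhaseScale B) U) * Ψ U) := mul_pos (div_pos hν0 hL) hcpos
      have hρ : 0 < 8 * ((t / 2) ^ 9 * ((2 * π ^ 2)⁻¹) ^ 3) := by positivity
      by_contra h
      have h2 : ∫ y, gFlat B Ψ y ^ 2 ≤ 0 := not_lt.1 h
      nlinarith [hM0low.trans hM]
    have hI : (1 / 2 : ℝ) * ∫ y, gFlat B Ψ y ^ 2 ≤ ∫ x, (∑ i, a i * u i x) ^ 2 := by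
      have : (1 / 2 : ℝ) ≤ 1 - 4 * a' - 2 * t ^ 2 := by linarith
      exact (mul_le_mul_of_nonneg_right this hm0.le).trans hmass
    refine ⟨lt_of_lt_of_le (by positivity) hI, hEn.trans ?_⟩
    have h46 : 0 ≤ 4 * a' / t + 4706 := by positivity
    calc (4 * a' / t + 4706) * ∫ y, gFlat B Ψ y ^ 2 = s * ((1 / 2 : ℝ) * ∫ y, gFlat B Ψ y ^ 2) := by rw [hs]; ring
      _ ≤ s * ∫ x, (∑ i, a i * u i x) ^ 2 := mul_le_mul_of_nonneg_left hI hs0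
  refine physLevel_le_of_kacFamily u huK hs0 (fun a ha => (chain a ha).1) fun a => ?_
  by_cases ha : a = 0
  · subst ha
    have e1 : (fun x => ∑ i, (0 : Fin (n + 1) → ℝ) i * u i x) = fun _ => (0 : ℝ) := by funext x; simp
    rw [e1, energyForm_zero]
    exact mul_nonneg hs0 (integral_nonneg fun x => sq_nonneg _)
  · exact (chain a ha).2

/-! ### §3. Finite bilinearity of `l2` and `qform` over physical families -/

/-- `⟨Σ_i a_i ψ_i, φ⟩ = Σ_i a_i ⟨ψ_i, φ⟩` (physical test functions, one site). [folklore] -/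
theorem l2_sum_mul_left {ι : Type*} (s : Finset ι) (ψ : ι → Cfg → ℝ) (hψ : ∀ i, IsPhys (ψ i)) (a : ι → ℝ)
    {φ : Cfg → ℝ} (hφ : IsPhys φ) :
    l2 (fun U => ∑ i ∈ s, a i * ψ i U) φ = ∑ i ∈ s, a i * l2 (ψ i) φ := by
  classical
  induction s using Finset.induction_on with
  | empty =>
    have e : (fun U : Cfg => ∑ i ∈ (∅ : Finset ι), a i * ψ i U) = (0 : ℝ) • φ := by funext U; simp
    rw [e, l2_smul_left, Finset.sum_empty, zero_mul]
  | insert j s hj ih =>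
    have e : (fun U => ∑ i ∈ insert j s, a i * ψ i U) = (a j • ψ j) + fun U => ∑ i ∈ s, a i * ψ i U := by
      funext U; simp [Finset.sum_insert hj]
    rw [e, l2_add_left ((hψ j).smul (a j)) (isPhys_sum_mul s ψ hψ a) hφ, l2_smul_left, ih, Finset.sum_insert hj]

/-- `⟨Σ a_iψ_i, Σ b_jψ_j⟩ = Σ_i Σ_j a_i b_j ⟨ψ_i, ψ_j⟩`. [folklore] -/
theorem l2_sum_mul_sum_mul {ι : Type*} (s : Finset ι) (ψ : ι → Cfg → ℝ) (hψ : ∀ i, IsPhys (ψ i)) (a b : ι → ℝ) :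
    l2 (fun U => ∑ i ∈ s, a i * ψ i U) (fun U => ∑ j ∈ s, b j * ψ j U) = ∑ i ∈ s, ∑ j ∈ s, a i * b j * l2 (ψ i) (ψ j) := by
  rw [l2_sum_mul_left s ψ hψ a (isPhys_sum_mul s ψ hψ b)]
  refine Finset.sum_congr rfl fun i _ => ?_
  rw [l2_comm, l2_sum_mul_left s ψ hψ b (hψ i), Finset.mul_sum]
  refine Finset.sum_congr rfl fun j _ => ?_
  rw [l2_comm]; ring

/-- `⟨Σ_i a_i ψ_i, K_B φ⟩ = Σ_i a_i ⟨ψ_i, K_B φ⟩`. [folklore] -/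
theorem qform_sum_mul_left {ι : Type*} (s : Finset ι) (B : ℝ) (ψ : ι → Cfg → ℝ) (hψ : ∀ i, IsPhys (ψ i)) (a : ι → ℝ)
    {φ : Cfg → ℝ} (hφ : IsPhys φ) :
    qform su2Rep B (fun U => ∑ i ∈ s, a i * ψ i U) φ = ∑ i ∈ s, a i * qform su2Rep B (ψ i) φ := by
  classical
  induction s using Finset.induction_on with
  | empty =>
    have e : (fun U : Cfg => ∑ i ∈ (∅ : Finset ι), a i * ψ i U) = (0 : ℝ) • φ := by funext U; simp
    rw [e, qform_smul_left, Finset.sum_empty, zero_mul]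
  | insert j s hj ih =>
    have e : (fun U => ∑ i ∈ insert j s, a i * ψ i U) = (a j • ψ j) + fun U => ∑ i ∈ s, a i * ψ i U := by
      funext U; simp [Finset.sum_insert hj]
    rw [e, qform_add_left B ((hψ j).smul (a j)) (isPhys_sum_mul s ψ hψ a) hφ, qform_smul_left, ih, Finset.sum_insert hj]

/-- `⟨Σ a_iψ_i, K_B Σ b_jψ_j⟩ = Σ_i Σ_j a_i b_j ⟨ψ_i, K_B ψ_j⟩`. [folklore] -/
theorem qform_sum_mul_sum_mul {ι : Type*} (s : Finset ι) (B : ℝ) (ψ : ι → Cfg → ℝ) (hψ : ∀ i, IsPhys (ψ i)) (a b : ι → ℝ) :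
    qform su2Rep B (fun U => ∑ i ∈ s, a i * ψ i U) (fun U => ∑ j ∈ s, b j * ψ j U) =
      ∑ i ∈ s, ∑ j ∈ s, a i * b j * qform su2Rep B (ψ i) (ψ j) := by
  rw [qform_sum_mul_left s B ψ hψ a (isPhys_sum_mul s ψ hψ b)]
  refine Finset.sum_congr rfl fun i _ => ?_
  rw [qform_su2Rep_comm B (hψ i) (isPhys_sum_mul s ψ hψ b), qform_sum_mul_left s B ψ hψ b (hψ i), Finset.mul_sum]
  refine Finset.sum_congr rfl fun j _ => ?_
  rw [qform_su2Rep_comm B (hψ j) (hψ i)]; ring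

/-! ### §4. The exact eigenfamily as a high family -/

/-- For an `l2`-orthonormal physical eigenfamily `K_B e_i = λ_i e_i`: `‖Σ a_ie_i‖² = Σ a_i²` and `⟨Σa_ie_i, K_B Σa_ie_i⟩ = Σ λ_i a_i²`.
[cite: ReedSimonIV1978, Thm. XIII.1] -/
theorem forms_of_eigenfamily {B : ℝ} {k : ℕ} {e : Fin (k + 1) → Cfg → ℝ} (he : ∀ i, IsPhys (e i))
    (hon : ∀ i l, l2 (e i) (e l) = if i = l then 1 else 0)
    (heig : ∀ i : Fin (k + 1), transferApply B (e i) = levelValue su2Rep 1 B (i : ℕ) • e i)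
    (a : Fin (k + 1) → ℝ) :
    l2 (fun U => ∑ i, a i * e i U) (fun U => ∑ i, a i * e i U) = ∑ i, a i ^ 2 ∧
      qform su2Rep B (fun U => ∑ i, a i * e i U) (fun U => ∑ i, a i * e i U)
        = ∑ i : Fin (k + 1), levelValue su2Rep 1 B (i : ℕ) * a i ^ 2 := by
  constructor
  · rw [l2_sum_mul_sum_mul Finset.univ e he a a]
    refine Finset.sum_congr rfl fun i _ => ?_
    rw [Finset.sum_eq_single i (fun j _ hji => by rw [hon]; simp [Ne.symm hji]) (fun h => (h (Finset.mem_univ i)).elim)]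
    rw [hon]; simp [sq]
  · rw [qform_sum_mul_sum_mul Finset.univ B e he a a]
    refine Finset.sum_congr rfl fun i _ => ?_
    have hq : ∀ j : Fin (k + 1), qform su2Rep B (e i) (e j) = levelValue su2Rep 1 B (j : ℕ) * l2 (e i) (e j) := fun j => by
      rw [qform_eq_l2_transferApply, heig, l2_comm, l2_smul_left, l2_comm]
    simp_rw [hq]
    rw [Finset.sum_eq_single i (fun j _ hji => by rw [hon]; simp [Ne.symm hji]) (fun h => (h (Finset.mem_univ i)).elim)]
    rw [hon]; simp [sq]; ring

/-! ### §5. The count in level form at a fixed coupling -/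

/-- **THE B-UNIFORM COUNT, level form (fixed `B`).**  Under the hypotheses of `physLevel_le_of_highFamily` for a number `μ`
(`B ≥ 2`, `λ_b ≤ 1/600`, OUTER gain `γ ≤ 1`, window, smallness): for every `k` with `2(4a′/λ_b + 4706) < physLevel (k+1)` one has
`λ_k(B) ≤ μ`.  (Else the exact eigenfamily `e_0 … e_k` is a high `(k+1)`-family with floor `λ_k > μ`.) [cite: ReedSimonIV1978, Thm. XIII.1]
[cite: SimonB1983DiscreteSpectrum, §3] -/
theorem levelValue_le_of_physLevel_gt_at {B μ γ : ℝ} (hB2 : 2 ≤ B) (ht600 : bareLambda B ≤ 1 / 600) (hγ : γ ≤ 1)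
    (hout : ∀ φ : Cfg → ℝ, IsPhys φ →
      qform su2Rep B (fun U => Real.sin (onePhase (onePhaseScale B) U) * φ U) (fun U => Real.sin (onePhase (onePhaseScale B) U) * φ U)
        ≤ linkCE B * (1 - γ) * l2 (fun U => Real.sin (onePhase (onePhaseScale B) U) * φ U) (fun U => Real.sin (onePhase (onePhaseScale B) U) * φ U))
    (hμL : μ ≤ linkCE B)
    (hwin : linkCE B * (1 - γ + 9 / 4 * (Real.pi ^ 2 / 4) * cM2 * bareLambda B ^ 2) < μ)
    (hsmall : 4 * (linkCE B / (μ - linkCE B * (9 / 4 * (Real.pi ^ 2 / 4) * cM2 * bareLambda B ^ 2)) - 1) + 2 * bareLambda B ^ 2 ≤ 1 / 2)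
    {k : ℕ} (hk : 2 * (4 * (linkCE B / (μ - linkCE B * (9 / 4 * (Real.pi ^ 2 / 4) * cM2 * bareLambda B ^ 2)) - 1) / bareLambda B + 4706)
      < physLevel (k + 1)) :
    levelValue su2Rep 1 B k ≤ μ := by
  have hBpos : 0 < B := by linarith
  by_contra hlt
  push Not at hlt
  obtain ⟨e, he, hon, heig⟩ := exists_isPhys_eigenfamily_of_pos (L := 1) hBpos k
  have hfam : ∀ a : Fin (k + 1) → ℝ, a ≠ 0 →
      0 < l2 (fun U => ∑ i, a i * e i U) (fun U => ∑ i, a i * e i U) ∧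
        μ * l2 (fun U => ∑ i, a i * e i U) (fun U => ∑ i, a i * e i U)
          ≤ qform su2Rep B (fun U => ∑ i, a i * e i U) (fun U => ∑ i, a i * e i U) := by
    intro a ha
    obtain ⟨hl2, hq⟩ := forms_of_eigenfamily he hon heig a
    have hpos : 0 < ∑ i, a i ^ 2 := by
      obtain ⟨j, hj⟩ : ∃ j, a j ≠ 0 := by
        by_contra h; push Not at h; exact ha (funext h)
      exact lt_of_lt_of_le (by positivity) (Finset.single_le_sum (fun i _ => sq_nonneg (a i)) (Finset.mem_univ j))
    rw [hl2, hq]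
    refine ⟨hpos, ?_⟩
    rw [Finset.mul_sum]
    refine Finset.sum_le_sum fun i _ => mul_le_mul_of_nonneg_right ?_ (sq_nonneg _)
    exact (hlt.trans_le (levelValue_le_of_le hBpos (Nat.le_of_lt_succ i.2))).le
  have h := physLevel_le_of_highFamily hB2 ht600 hγ hout hμL hwin hsmall e he hfam
  linarith

end Summit.QuantumFields.YangMills.Theorems.FemtoTransferGap.OST

end
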